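import Literature.NumberTheory.Automorphic.JacquetRankStrictMono
import Literature.NumberTheory.Automorphic.JacquetModuleFrobeniusProofs
import HarnessLib

/-!
# A smooth representation embedding in a normalised induction `i_P(σ)` has a non-zero Jacquet module; on a Jacquet LINE the Levi acts
# by the inducing character

Generic representation theory (theorems only; no definition, no named fact, no instance) over ★ Frobenius reciprocity for normalised
induction `Hom_G(π, i_P σ) ≃ₗ Hom_M(r_P π, σ)` (★ `Representation.frobenius_normalizedInd_holds`, `Automorphic/JacquetModuleFrobeniusProofs`,
[BernsteinZelevinsky1977, Prop. 1.9 (b)]; [Casselman1995, Thm. 3.2.4]) and ★ `Automorphic/JacquetRankStrictMono` §4.  For a parabolic triple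
`t = (P, M, N)` with `δ_P` trivial on `N`:

* §1 `nontrivial_coinvariants_of_intertwiningMap_normalizedInd_ne_zero` — a smooth `π` with a NON-ZERO `G`-map `π → i_P(σ)` has `r_P π ≠ 0`
  (its Frobenius image is a non-zero `M`-map out of `r_P π`); `…_of_injective_…` — in particular for `π ≠ 0` EMBEDDING in `i_P(σ)`
  ([Casselman1995, Cor. 6.3.7: «every irreducible composition factor … has a non-zero Jacquet module» in the embedded case]).
* §2 `normalizedJacquet_apply_eq_smul_of_finrank_eq_one_of_intertwiningMap_normalizedInd` — if moreover `σ = ℂ_θ` is a character and `r_P π`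
  is a LINE, then `M` acts on `r_P π` by `θ`, so every exponent of `π` is `θ` pointwise (`apply_eq_of_eigenvector_…`) — the step «`π_N` has
  length one, hence `π_N ≅ σδ^{1/2}`» of [Casselman1995, Prop. 7.1.3].

Stated for an ABSTRACT `i_P(σ) = Representation.normalizedInd t σ`, so that consumers at a concrete carrier (the T3 «KeysCaseTwo» pay-down of
cell pub/hodgecm-mathlib F0∕P3: `cmPrincipalSeries L 3 v χ`, definitionally `normalizedInd (cmBorelTriple L 3 v) (ℂ_χ)`) cross the
definitional identification once and do all Frobenius bookkeeping here, generically.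

## References
[BernsteinZelevinsky1977] Prop. 1.9 (b), §2.3 · [Casselman1995] Thm. 3.2.4 p. 34, Cor. 6.3.7 p. 59, Prop. 7.1.3 p. 67.
-/

set_option autoImplicit false

noncomputable section

namespace Representation

open Literature.NumberTheory.Automorphic

variable {G : Type*} [Group G] [TopologicalSpace G] [IsTopologicalGroup G] (t : ParabolicTriple G) [LocallyCompactSpace t.P]
  {V : Type*} [AddCommGroup V] [Module ℂ V] (π : Representation ℂ G V)

/-! ## §1 A non-zero map to `i_P(σ)` forces `r_P ≠ 0` -/

/-- **A smooth `π` with a non-zero `G`-map to a normalised induction `i_P(σ)` has `r_P π ≠ 0`**: under ★ Frobenius (a LINEAR equivalence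
`Hom_G(π, i_P σ) ≃ₗ Hom_M(r_P π, σ)`) the map corresponds to a non-zero `M`-map out of `r_P π`, which is therefore not the zero space.
[cite: BernsteinZelevinsky1977, Prop. 1.9 (b)] [cite: Casselman1995, Thm. 3.2.4 p. 34; Cor. 6.3.7 p. 59] -/
theorem nontrivial_coinvariants_of_intertwiningMap_normalizedInd_ne_zero
    (hδ : ∀ (n : G) (hn : n ∈ t.N), deltaChar t.P ⟨n, t.N_le hn⟩ = 1) (hπ : π.IsSmooth)
    {W : Type*} [AddCommGroup W] [Module ℂ W] (σ : Representation ℂ ↥t.M W)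
    (f : π.IntertwiningMap (Representation.normalizedInd t σ)) (hf : f ≠ 0) :
    Nontrivial (t.restrict π).Coinvariants := by
  obtain ⟨Φ⟩ := Representation.frobenius_normalizedInd_holds t hδ π σ hπ
  have hΦ : Φ f ≠ 0 := fun h0 => hf (Φ.map_eq_zero_iff.1 h0)
  by_contra hsub
  rw [not_nontrivial_iff_subsingleton] at hsub
  exact hΦ (Representation.IntertwiningMap.ext (LinearMap.ext fun x => by
    rw [Representation.IntertwiningMap.zero_toLinearMap, LinearMap.zero_apply, Subsingleton.elim x 0, map_zero]))

/-- **A smooth `π ≠ 0` EMBEDDING in `i_P(σ)` has `r_P π ≠ 0`.** [cite: Casselman1995, Cor. 6.3.7 p. 59; Cor. 6.3.9 (b) p. 60]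
[cite: BernsteinZelevinsky1977, Prop. 1.9 (b)] -/
theorem nontrivial_coinvariants_of_injective_normalizedInd [Nontrivial V]
    (hδ : ∀ (n : G) (hn : n ∈ t.N), deltaChar t.P ⟨n, t.N_le hn⟩ = 1) (hπ : π.IsSmooth)
    {W : Type*} [AddCommGroup W] [Module ℂ W] (σ : Representation ℂ ↥t.M W)
    (f : π.IntertwiningMap (Representation.normalizedInd t σ)) (hf : Function.Injective f) :
    Nontrivial (t.restrict π).Coinvariants := by
  refine nontrivial_coinvariants_of_intertwiningMap_normalizedInd_ne_zero t π hδ hπ σ f fun h0 => ?_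
  obtain ⟨x, hx⟩ := exists_ne (0 : V)
  have hx0 : f x = f 0 := by rw [h0, Representation.IntertwiningMap.coe_zero, Pi.zero_apply, Pi.zero_apply]
  exact hx (hf hx0)

/-! ## §2 On a Jacquet line the Levi acts by the inducing character -/

/-- **If `r_P π` is a line and `π` maps non-trivially to `i_P(ℂ_θ)`, then `M` acts on `r_P π` by `θ`** (★
`normalizedJacquet_apply_eq_smul_of_finrank_eq_one` applied to the Frobenius image of the map). [cite: Casselman1995, Prop. 7.1.3 p. 67; Thm. 3.2.4]
[cite: BernsteinZelevinsky1977, Prop. 1.9 (b)] -/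
theorem normalizedJacquet_apply_eq_smul_of_finrank_eq_one_of_intertwiningMap_normalizedInd
    (hδ : ∀ (n : G) (hn : n ∈ t.N), deltaChar t.P ⟨n, t.N_le hn⟩ = 1) (hπ : π.IsSmooth) (θ : ↥t.M →* ℂˣ)
    (h1 : Module.finrank ℂ (t.restrict π).Coinvariants = 1)
    (f : π.IntertwiningMap (Representation.normalizedInd t ((Representation.trivial ℂ ↥t.M ℂ).twist θ))) (hf : f ≠ 0)
    (m : ↥t.M) (x : (t.restrict π).Coinvariants) :
    π.normalizedJacquet t m x = ((θ m : ℂˣ) : ℂ) • x := by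
  obtain ⟨Φ⟩ := Representation.frobenius_normalizedInd_holds t hδ π ((Representation.trivial ℂ ↥t.M ℂ).twist θ) hπ
  exact normalizedJacquet_apply_eq_smul_of_finrank_eq_one t π θ h1 (Φ f) (fun h0 => hf (Φ.map_eq_zero_iff.1 h0)) m x

/-- Hence **every exponent of such a `π` equals `θ` pointwise** (eigenvector form). [cite: Casselman1995, §4.4 p. 45; Prop. 7.1.3 p. 67] -/
theorem apply_eq_of_eigenvector_of_finrank_eq_one_of_intertwiningMap_normalizedInd
    (hδ : ∀ (n : G) (hn : n ∈ t.N), deltaChar t.P ⟨n, t.N_le hn⟩ = 1) (hπ : π.IsSmooth) (θ : ↥t.M →* ℂˣ)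
    (h1 : Module.finrank ℂ (t.restrict π).Coinvariants = 1)
    (f : π.IntertwiningMap (Representation.normalizedInd t ((Representation.trivial ℂ ↥t.M ℂ).twist θ))) (hf : f ≠ 0)
    {χ' : ↥t.M →* ℂˣ} {w : (t.restrict π).Coinvariants} (hw0 : w ≠ 0)
    (hw : ∀ m : ↥t.M, π.normalizedJacquet t m w = ((χ' m : ℂˣ) : ℂ) • w) (m : ↥t.M) :
    ((χ' m : ℂˣ) : ℂ) = ((θ m : ℂˣ) : ℂ) := by
  have e := (hw m).symm.trans
    (normalizedJacquet_apply_eq_smul_of_finrank_eq_one_of_intertwiningMap_normalizedInd t π hδ hπ θ h1 f hf m w)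
  exact smul_left_injective ℂ hw0 e

end Representation

end
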